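/-
Copyright (c) 2026. All rights reserved.
Released under Apache 2.0 license as described in the file LICENSE.
Authors: HodgeCM publication cell (pub-hodgecm), model-construction sub-cell, construction prover `mc-weil-1`.
-/
import Literature.RepresentationTheory.HeisenbergGroup.SchrodingerSiegelParabolic
import Mathlib.MeasureTheory.Group.Integral
import Mathlib.Algebra.Algebra.Bilinear

/-!
# The Weyl element in the Schrödinger model: the `β`-Fourier transform as an intertwining operator

Topic `RepresentationTheory/HeisenbergGroup`; namespace `Literature.RepresentationTheory.HeisenbergGroup`.

For a pairing `β : X →ₗ[R] Y →ₗ[R] R`, a unitary character `ψ : AddChar R Circle` and a measure `μ` on `X` we CONSTRUCT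
* §1 the OPPOSITE pairing `negFlip β : Y →ₗ X →ₗ R`, `(y, x) ↦ -β x y`, and the group homomorphism
  `swapHom β : Heisenberg (polar β) →* Heisenberg (polar (negFlip β))`, `((x,y),t) ↦ ((y,x), t - β x y)` (exchange of
  the two lagrangians); the Weyl-type elements `weylElt β γ δ h ∈ PseudoSymplectic (polar β)`,
  `σ(x,y) = (γ y, δ x)`, `f(x,y) = -β x y`, for `γ : Y ≃ X`, `δ : X ≃ Y` with `β (γ y) (δ x) = -β x y` (Weil's `d₀'(γ)`,
  n° 6, p. 151: "`σ = (0, -γ*⁻¹; γ, 0)`… on satisfait à (6) en prenant `f(u,u*) = ⟨u, -u*⟩`"; MVW Chap. 2 II.6: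
  `g = (0, b; b*⁻¹… , 0)`);
* §2 the **`β`-Fourier transform** `betaFourier β ψ μ f (w) = ∫ ψ(β v w) f(v) dμ(v)` from functions on `X` to functions
  on `Y` (for `X = Y = F` a field and `β` = multiplication this IS the tree's `fourierSB ψ μ`:
  `betaFourier_mul_eq_fourierSB`), and the KERNEL intertwining identity, valid for EVERY `f : X → ℂ` and every
  right-invariant `μ` (change of variables `v ↦ v - x` + pulling out a constant — no integrability needed):

    `betaFourier (ρ_X(h) f) = ρ_Y(swapHom h) (betaFourier f)`   (`betaFourier_schrodinger`),

  where `ρ_X = schrodinger β ψ` and `ρ_Y = schrodinger (negFlip β) ψ` (MVW Chap. 2 II.6, third formula: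
  "`M[g]f(x*) = ∫_Y ψ(⟨x, x*⟩) f(b⁻¹x) dx`"; Weil n° 13, p. 160: "`d₀'(γ)Φ(x) = |γ|^{1/2} Φ*(-xγ*⁻¹)`, où `Φ*` désigne la
  transformée de Fourier de `Φ`");
* §3 in the presence of self-dual data `(γ, δ)` as in §1, the **Weyl operator** `weylFun f = (betaFourier f) ∘ γ⁻¹` on
  functions on `X` and the identity `weylFun (ρ(h) f) = ρ(weylElt · h) (weylFun f)` for all `f` (`weylFun_schrodinger`)
  — MVW's condition (A) at the level of functions; its linear restriction to the Schwartz–Bruhat space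
  `weylOpSB : 𝒮(X) →ₗ[ℂ] (X → ℂ)` (Schwartz–Bruhat functions are `μ`-integrable for `μ` finite on compacts:
  `integrable_of_mem_schwartzBruhat`), and the same identity for `schrodingerSB`.

What is NOT done here and is carried as explicit, named hypotheses by the users of this file (each is a THEOREM in
the rank-one non-archimedean case, in the tree): (i) `betaFourier` maps `𝒮(X)` to `𝒮(Y)` — for `X = Y = F` a
non-archimedean local field this is `Literature.NumberTheory.Automorphic.fourierSB_mem_schwartzBruhat`
(`TateLocalSchwartzBruhat.lean`), transported by `betaFourier_mul_eq_fourierSB`; (ii) Fourier inversion for a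
self-dual `μ` (the tree's record `IsSelfDualMeasure ψ μ`, Tate 1950 Thm 2.2.2), which is what makes the Weyl operator
INVERTIBLE on `𝒮(X)` and hence a member of `mpPairs (schrodingerSB …)` (`SchrodingerSiegelParabolic.lean`); the
packaging of (i)+(ii) into that membership is `weylPair_mem_mpPairs` below, with (i) and (ii) as hypotheses.
No property of the constructed objects is assumed: the file has no hypothesis records of its own.
-/

set_option autoImplicit false

noncomputable section

namespace Literature.RepresentationTheory.HeisenbergGroup

open _root_.MeasureTheory
open Literature.NumberTheory.Automorphic (SchwartzBruhat mem_schwartzBruhat_iff fourierSB fourierSB_apply)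

universe u v w

variable {R : Type u} [CommRing R] {X : Type v} {Y : Type w} [AddCommGroup X] [Module R X] [AddCommGroup Y]
  [Module R Y]

/-! ## §1 Exchange of the lagrangians and the Weyl-type elements -/

section Swap

variable (β : X →ₗ[R] Y →ₗ[R] R)

/-- the opposite pairing `negFlip β y x = -β x y` on `Y × X`. [cite: Weil1964, n° 6, p. 151] -/
def negFlip : Y →ₗ[R] X →ₗ[R] R := -β.flip

/-- formula. [cite: Weil1964, n° 6, p. 151] -/
@[simp] theorem negFlip_apply (y : Y) (x : X) : negFlip β y x = -β x y := rfl

/-- **exchange of the lagrangians**: `((x,y),t) ↦ ((y,x), t - β x y)` is a group homomorphism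
`Heisenberg (polar β) →* Heisenberg (polar (negFlip β))` (the correction `-β x y` absorbs the non-symmetry of the
polarised cocycle). [cite: Weil1964, n° 6, p. 151] -/
def swapHom : Heisenberg (polar β) →* Heisenberg (polar (negFlip β)) where
  toFun h := ⟨(h.v.2, h.v.1), h.t - β h.v.1 h.v.2⟩
  map_one' := by
    apply Heisenberg.ext
    · rfl
    · simp only [Heisenberg.one_t, Heisenberg.one_v, Prod.fst_zero, Prod.snd_zero, map_zero, sub_zero]
  map_mul' h h' := by
    apply Heisenberg.ext
    · rfl
    · simp only [Heisenberg.mul_t, Heisenberg.mul_v, polar_apply, negFlip_apply, Prod.fst_add, Prod.snd_add,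
        map_add, LinearMap.add_apply]
      abel

/-- components of `swapHom`. [cite: Weil1964, n° 6, p. 151] -/
@[simp] theorem swapHom_v (h : Heisenberg (polar β)) : (swapHom β h).v = (h.v.2, h.v.1) := rfl

/-- central component of `swapHom`. [cite: Weil1964, n° 6, p. 151] -/
@[simp] theorem swapHom_t (h : Heisenberg (polar β)) : (swapHom β h).t = h.t - β h.v.1 h.v.2 := rfl

/-- `swapHom` is injective. [cite: Weil1964, n° 6, p. 151] -/
theorem swapHom_injective : Function.Injective (swapHom β) := by
  intro h h' e
  have hv := congrArg Heisenberg.v e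
  have ht := congrArg Heisenberg.t e
  simp only [swapHom_v, Prod.mk.injEq] at hv
  simp only [swapHom_t, hv.1, hv.2, sub_left_inj] at ht
  exact Heisenberg.ext (Prod.ext hv.2 hv.1) ht

variable (γ : Y ≃ₗ[R] X) (δ : X ≃ₗ[R] Y)

/-- the linear automorphism `(x, y) ↦ (γ y, δ x)` of `X × Y`. [cite: Weil1964, n° 6, p. 151] -/
def weylσ : (X × Y) ≃ₗ[R] (X × Y) where
  toFun p := (γ p.2, δ p.1)
  map_add' p p' := by simp only [Prod.snd_add, Prod.fst_add, map_add, Prod.mk_add_mk]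
  map_smul' c p := by simp only [Prod.smul_snd, Prod.smul_fst, map_smul, RingHom.id_apply, Prod.smul_mk]
  invFun p := (δ.symm p.2, γ.symm p.1)
  left_inv p := by simp only [LinearEquiv.symm_apply_apply, Prod.mk.eta]
  right_inv p := by simp only [LinearEquiv.apply_symm_apply, Prod.mk.eta]

/-- formula. [cite: Weil1964, n° 6, p. 151] -/
@[simp] theorem weylσ_apply (p : X × Y) : weylσ γ δ p = (γ p.2, δ p.1) := rfl

/-- formula for the inverse. [cite: Weil1964, n° 6, p. 151] -/
@[simp] theorem weylσ_symm_apply (p : X × Y) : (weylσ γ δ).symm p = (δ.symm p.2, γ.symm p.1) := rfl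

/-- **Weyl-type element** `d₀'(γ, δ) = ((0, γ; δ, 0), (x,y) ↦ -β x y) ∈ PseudoSymplectic (polar β)` for
`β (γ y) (δ x) = -β x y` (Weil n° 6: `f(u, u*) = ⟨u, -u*⟩`). [cite: Weil1964, n° 6, p. 151] -/
def weylElt (hγδ : ∀ (x : X) (y : Y), β (γ y) (δ x) = -β x y) : Heisenberg.PseudoSymplectic (polar β) where
  σ := weylσ γ δ
  f p := -β p.1 p.2
  cocycle := by
    intro p p'
    simp only [Prod.fst_add, Prod.snd_add, map_add, LinearMap.add_apply, weylσ_apply, polar_apply, hγδ]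
    abel

/-- `σ`-component of a Weyl element. [cite: Weil1964, n° 6, p. 151] -/
@[simp] theorem weylElt_σ (hγδ : ∀ (x : X) (y : Y), β (γ y) (δ x) = -β x y) (p : X × Y) :
    (weylElt β γ δ hγδ).σ p = (γ p.2, δ p.1) := rfl

/-- `f`-component of a Weyl element. [cite: Weil1964, n° 6, p. 151] -/
@[simp] theorem weylElt_f (hγδ : ∀ (x : X) (y : Y), β (γ y) (δ x) = -β x y) (p : X × Y) :
    (weylElt β γ δ hγδ).f p = -β p.1 p.2 := rfl

/-- action of a Weyl element: `((x,y),t) ↦ ((γ y, δ x), t - β x y)`. [cite: Weil1964, n° 6, p. 151] -/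
theorem weylElt_act (hγδ : ∀ (x : X) (y : Y), β (γ y) (δ x) = -β x y) (h : Heisenberg (polar β)) :
    (weylElt β γ δ hγδ).act h = ⟨(γ h.v.2, δ h.v.1), h.t - β h.v.1 h.v.2⟩ := by
  apply Heisenberg.ext
  · rfl
  · simp only [Heisenberg.PseudoSymplectic.act_t, weylElt_f, sub_eq_add_neg]

end Swap

/-! ## §2 The `β`-Fourier transform and its intertwining property -/

section Fourier

variable (β : X →ₗ[R] Y →ₗ[R] R) (ψ : AddChar R Circle) [MeasurableSpace X] (μ : Measure X)

/-- the **`β`-Fourier transform** `f ↦ (w ↦ ∫ ψ(β v w) f(v) dμ(v))` from functions on `X` to functions on `Y`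
(MVW II.6: `∫ ψ(⟨x, x*⟩) f(…) dx`; Weil: `Φ*`). [cite: MoeglinVignerasWaldspurger1987, Chap. 2 II.6] -/
def betaFourier (f : X → ℂ) : Y → ℂ := fun w => ∫ v, (ψ (β v w) : ℂ) * f v ∂μ

/-- formula. [cite: MoeglinVignerasWaldspurger1987, Chap. 2 II.6] -/
theorem betaFourier_apply (f : X → ℂ) (w : Y) : betaFourier β ψ μ f w = ∫ v, (ψ (β v w) : ℂ) * f v ∂μ := rfl

/-- for `X = Y = F` a field and `β` = multiplication, `betaFourier` is the tree's Tate–Fourier transform `fourierSB`.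
[cite: Tate1950, §2.2] -/
theorem betaFourier_mul_eq_fourierSB {F : Type u} [Field F] [MeasurableSpace F] (ψF : AddChar F Circle)
    (μF : Measure F) (f : F → ℂ) : betaFourier (LinearMap.mul F F) ψF μF f = fourierSB ψF μF f := by
  funext y
  rw [betaFourier_apply, fourierSB_apply]
  rfl

/-- homogeneity of `betaFourier` (unconditional). [folklore] -/
theorem betaFourier_smul (c : ℂ) (f : X → ℂ) : betaFourier β ψ μ (c • f) = c • betaFourier β ψ μ f := by
  funext w
  simp only [betaFourier_apply, Pi.smul_apply, smul_eq_mul]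
  rw [← integral_const_mul]
  congr 1
  funext v
  ring

/-- additivity of `betaFourier` on functions whose modulated versions are integrable. [folklore] -/
theorem betaFourier_add {f g : X → ℂ} (w : Y) (hf : Integrable (fun v => (ψ (β v w) : ℂ) * f v) μ)
    (hg : Integrable (fun v => (ψ (β v w) : ℂ) * g v) μ) :
    betaFourier β ψ μ (f + g) w = betaFourier β ψ μ f w + betaFourier β ψ μ g w := by
  simp only [betaFourier_apply, Pi.add_apply, mul_add]
  exact integral_add hf hg

variable [MeasurableAdd X] [μ.IsAddRightInvariant]

/-- **The intertwining identity, pointwise**: for every `f : X → ℂ` (no integrability needed) and every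
right-invariant `μ`, `(betaFourier (ρ(h) f))(w) = ψ(t - β x y - β x w) · (betaFourier f)(w + y)` for `h = ((x,y),t)` —
the substitution `v ↦ v - x`. [cite: MoeglinVignerasWaldspurger1987, Chap. 2 II.6] -/
theorem betaFourier_schrodinger_apply (h : Heisenberg (polar β)) (f : X → ℂ) (w : Y) :
    betaFourier β ψ μ (schrodinger β ψ h f) w
      = (ψ (h.t - β h.v.1 h.v.2 - β h.v.1 w) : ℂ) * betaFourier β ψ μ f (w + h.v.2) := by
  simp only [betaFourier_apply, schrodinger_apply]
  rw [← integral_const_mul]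
  conv_lhs => rw [← integral_add_right_eq_self _ (-h.v.1)]
  refine integral_congr_ae (Filter.Eventually.of_forall fun v => ?_)
  simp only [neg_add_cancel_right]
  rw [← mul_assoc, ← mul_assoc, ← coe_addChar_add, ← coe_addChar_add]
  congr 2
  simp only [map_add, map_neg, LinearMap.add_apply, LinearMap.neg_apply]
  abel

/-- **The `β`-Fourier transform intertwines the two Schrödinger models**:
`betaFourier ∘ ρ_X(h) = ρ_Y(swapHom h) ∘ betaFourier` on ALL functions, where `ρ_X = schrodinger β ψ` (functions on
`X`) and `ρ_Y = schrodinger (negFlip β) ψ` (functions on `Y`). [cite: MoeglinVignerasWaldspurger1987, Chap. 2 II.6] -/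
theorem betaFourier_schrodinger (h : Heisenberg (polar β)) (f : X → ℂ) :
    betaFourier β ψ μ (schrodinger β ψ h f) = schrodinger (negFlip β) ψ (swapHom β h) (betaFourier β ψ μ f) := by
  funext w
  rw [betaFourier_schrodinger_apply, schrodinger_apply, swapHom_t, swapHom_v, negFlip_apply, sub_eq_add_neg]

end Fourier

/-! ## §3 The Weyl operator for self-dual data -/

section Weyl

variable (β : X →ₗ[R] Y →ₗ[R] R) (ψ : AddChar R Circle) [MeasurableSpace X] (μ : Measure X)
variable (γ : Y ≃ₗ[R] X) (δ : X ≃ₗ[R] Y)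

/-- the **Weyl operator** on functions on `X`: `(weylFun f)(u) = (betaFourier f)(γ⁻¹ u) = ∫ ψ(β v (γ⁻¹ u)) f(v) dμ(v)`
(left-action form of Weil's `d₀'(γ)Φ(x) = |γ|^{1/2} Φ*(-xγ*⁻¹)`, without the unitarity scalar).
[cite: Weil1964, n° 13, p. 160] -/
def weylFun (f : X → ℂ) : X → ℂ := betaFourier β ψ μ f ∘ γ.symm

/-- formula. [cite: Weil1964, n° 13, p. 160] -/
theorem weylFun_apply (f : X → ℂ) (u : X) : weylFun β ψ μ γ f u = ∫ v, (ψ (β v (γ.symm u)) : ℂ) * f v ∂μ := rfl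

variable [MeasurableAdd X] [μ.IsAddRightInvariant]

/-- **MVW's condition (A) for the Weyl element, on all functions**: `weylFun (ρ(h) f) = ρ(d₀'(γ,δ) · h) (weylFun f)`
whenever `β (γ y) (δ x) = -β x y`. [cite: MoeglinVignerasWaldspurger1987, Chap. 2 II.6] -/
theorem weylFun_schrodinger (hγδ : ∀ (x : X) (y : Y), β (γ y) (δ x) = -β x y) (h : Heisenberg (polar β))
    (f : X → ℂ) :
    weylFun β ψ μ γ (schrodinger β ψ h f) = schrodinger β ψ ((weylElt β γ δ hγδ).act h) (weylFun β ψ μ γ f) := by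
  funext u
  simp only [weylFun, Function.comp_apply, betaFourier_schrodinger_apply, schrodinger_apply, weylElt_act, map_add,
    LinearEquiv.symm_apply_apply]
  congr 2
  have hu : β u (δ h.v.1) = -β h.v.1 (γ.symm u) := by
    rw [← hγδ h.v.1 (γ.symm u), LinearEquiv.apply_symm_apply]
  rw [hu]
  abel

end Weyl

/-! ### Restriction to Schwartz–Bruhat functions -/

section SchwartzBruhat

variable (β : X →ₗ[R] Y →ₗ[R] R) (ψ : AddChar R Circle) [MeasurableSpace X] (μ : Measure X)
variable [TopologicalSpace X] [TopologicalSpace R]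

/-- Schwartz–Bruhat functions are integrable for every measure finite on compacts. [folklore] -/
theorem integrable_of_mem_schwartzBruhat {V : Type*} [TopologicalSpace V] [MeasurableSpace V]
    [OpensMeasurableSpace V] (ν : Measure V) [IsFiniteMeasureOnCompacts ν] {f : V → ℂ}
    (hf : f ∈ SchwartzBruhat V) : Integrable f ν :=
  hf.1.continuous.integrable_of_hasCompactSupport hf.2

omit [MeasurableSpace X] in
/-- the modulated function `v ↦ ψ(β v w) f(v)` of a Schwartz–Bruhat `f` is Schwartz–Bruhat (for `ψ` locally constant,
`β(·, w)` continuous). [cite: MoeglinVignerasWaldspurger1987, Chap. 2 I.4 Exemple (1)] -/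
theorem modulation_mul_mem_schwartzBruhat (hψ : IsLocallyConstant (⇑ψ : R → Circle))
    (hβ : ∀ w : Y, Continuous fun v : X => β v w) (w : Y) {f : X → ℂ} (hf : f ∈ SchwartzBruhat X) :
    (fun v => (ψ (β v w) : ℂ) * f v) ∈ SchwartzBruhat X := by
  rw [mem_schwartzBruhat_iff] at hf ⊢
  have h1 := isLocallyConstant_modulation β ψ hψ hβ 0 w
  simp only [zero_add] at h1
  exact ⟨h1.mul hf.1, hf.2.mul_left⟩

/-- the modulated function of a Schwartz–Bruhat `f` is integrable. [folklore] -/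
theorem integrable_modulation_mul [OpensMeasurableSpace X] [IsFiniteMeasureOnCompacts μ]
    (hψ : IsLocallyConstant (⇑ψ : R → Circle)) (hβ : ∀ w : Y, Continuous fun v : X => β v w) (w : Y) {f : X → ℂ}
    (hf : f ∈ SchwartzBruhat X) : Integrable (fun v => (ψ (β v w) : ℂ) * f v) μ :=
  integrable_of_mem_schwartzBruhat μ (modulation_mul_mem_schwartzBruhat β ψ hψ hβ w hf)

variable [OpensMeasurableSpace X] [IsFiniteMeasureOnCompacts μ]

/-- the `β`-Fourier transform as a `ℂ`-LINEAR map on the Schwartz–Bruhat space of `X` (values: all functions on `Y`;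
that the values are Schwartz–Bruhat is hypothesis (i) of the module docstring, a theorem in rank one).
[cite: MoeglinVignerasWaldspurger1987, Chap. 2 II.6] -/
def betaFourierSB (hψ : IsLocallyConstant (⇑ψ : R → Circle)) (hβ : ∀ w : Y, Continuous fun v : X => β v w) :
    SchwartzBruhat X →ₗ[ℂ] (Y → ℂ) where
  toFun f := betaFourier β ψ μ f
  map_add' f g := by
    funext w
    exact betaFourier_add β ψ μ w (integrable_modulation_mul β ψ μ hψ hβ w f.2)
      (integrable_modulation_mul β ψ μ hψ hβ w g.2)
  map_smul' c f := betaFourier_smul β ψ μ c f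

/-- formula. [cite: MoeglinVignerasWaldspurger1987, Chap. 2 II.6] -/
@[simp] theorem betaFourierSB_apply (hψ : IsLocallyConstant (⇑ψ : R → Circle))
    (hβ : ∀ w : Y, Continuous fun v : X => β v w) (f : SchwartzBruhat X) :
    betaFourierSB β ψ μ hψ hβ f = betaFourier β ψ μ f := rfl

variable (γ : Y ≃ₗ[R] X)

/-- the Weyl operator as a `ℂ`-linear map `𝒮(X) →ₗ[ℂ] (X → ℂ)`. [cite: Weil1964, n° 13, p. 160] -/
def weylSB (hψ : IsLocallyConstant (⇑ψ : R → Circle)) (hβ : ∀ w : Y, Continuous fun v : X => β v w) :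
    SchwartzBruhat X →ₗ[ℂ] (X → ℂ) :=
  (LinearEquiv.funCongrLeft ℂ ℂ γ.symm.toEquiv).toLinearMap ∘ₗ betaFourierSB β ψ μ hψ hβ

/-- formula: `weylSB f = weylFun f`. [cite: Weil1964, n° 13, p. 160] -/
@[simp] theorem weylSB_apply (hψ : IsLocallyConstant (⇑ψ : R → Circle))
    (hβ : ∀ w : Y, Continuous fun v : X => β v w) (f : SchwartzBruhat X) :
    (weylSB β ψ μ γ hψ hβ f : X → ℂ) = weylFun β ψ μ γ f := rfl

variable (δ : X ≃ₗ[R] Y) [MeasurableAdd X] [μ.IsAddRightInvariant] [IsTopologicalAddGroup X]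

/-- **condition (A) for the Weyl operator on the Schwartz–Bruhat model**:
`weylSB (ρ(h) f) = ρ(d₀'(γ,δ) · h) (weylSB f)` for `f ∈ 𝒮(X)`, `ρ = schrodingerSB`.
[cite: MoeglinVignerasWaldspurger1987, Chap. 2 II.1 (A)] -/
theorem weylSB_schrodingerSB (hψ : IsLocallyConstant (⇑ψ : R → Circle))
    (hβ : ∀ w : Y, Continuous fun v : X => β v w)
    (hγδ : ∀ (x : X) (y : Y), β (γ y) (δ x) = -β x y) (h : Heisenberg (polar β)) (f : SchwartzBruhat X) :
    weylSB β ψ μ γ hψ hβ (schrodingerSB β ψ hψ hβ h f)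
      = schrodinger β ψ ((weylElt β γ δ hγδ).act h) (weylSB β ψ μ γ hψ hβ f) := by
  rw [weylSB_apply, weylSB_apply, coe_schrodingerSB, weylFun_schrodinger]

end SchwartzBruhat

/-! ## §4 The Weyl operator as an element of the metaplectic-type group of the smooth model

Under the two hypotheses (i) `weylFun` preserves `𝒮(X)` and (ii) the inversion formula `weylFun (weylFun f) = c · f(-·)`
on `𝒮(X)` for a unit `c` (both THEOREMS in rank one for a self-dual measure; here explicit hypotheses, never asserted),
the Weyl operator is a linear AUTOMORPHISM of `𝒮(X)` with the explicit inverse `f ↦ c⁻¹ · (weylFun f)(-·)`, and the pair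
`(weylElt, weylEquivSB)` lies in `mpPairs (schrodingerSB β ψ …)`. -/

section WeylEquiv

variable (β : X →ₗ[R] Y →ₗ[R] R) (ψ : AddChar R Circle) [MeasurableSpace X] (μ : Measure X)
variable [TopologicalSpace X] [TopologicalSpace R] [OpensMeasurableSpace X] [IsFiniteMeasureOnCompacts μ]
variable (γ : Y ≃ₗ[R] X)

omit [AddCommGroup Y] [Module R Y] [TopologicalSpace X] [TopologicalSpace R] [OpensMeasurableSpace X]
  [IsFiniteMeasureOnCompacts μ] in
/-- homogeneity of the Weyl operator on all functions. [folklore] -/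
theorem weylFun_smul {Y' : Type w} [AddCommGroup Y'] [Module R Y'] (β' : X →ₗ[R] Y' →ₗ[R] R) (γ' : Y' ≃ₗ[R] X)
    (c : ℂ) (f : X → ℂ) : weylFun β' ψ μ γ' (c • f) = c • weylFun β' ψ μ γ' f := by
  funext u
  simp only [weylFun, Function.comp_apply, betaFourier_smul, Pi.smul_apply]

variable [IsTopologicalAddGroup X]

omit [MeasurableSpace X] [OpensMeasurableSpace X] [IsFiniteMeasureOnCompacts μ] in
/-- the reflection `f ↦ f(-·)` preserves `𝒮(X)`. [folklore] -/
theorem reflect_mem_schwartzBruhat {f : X → ℂ} (hf : f ∈ SchwartzBruhat X) : (fun u => f (-u)) ∈ SchwartzBruhat X := by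
  rw [mem_schwartzBruhat_iff] at hf ⊢
  exact ⟨hf.1.comp_continuous continuous_neg, hf.2.comp_homeomorph (Homeomorph.neg X)⟩

omit [OpensMeasurableSpace X] [IsFiniteMeasureOnCompacts μ] [TopologicalSpace R] in
/-- **derived identity**: if `M² = c·P` on `𝒮(X)` (`M = weylFun`, `P f = f(-·)`), then `M P M = c` on `𝒮(X)` — because
`M²` is then surjective, so every `f ∈ 𝒮(X)` is `M g` with `g = c⁻¹ M (P f)`. [folklore] -/
theorem weylFun_reflect_weylFun (hW : ∀ f : SchwartzBruhat X, weylFun β ψ μ γ f ∈ SchwartzBruhat X) (c : ℂˣ)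
    (hinv : ∀ f : SchwartzBruhat X,
      weylFun β ψ μ γ (weylFun β ψ μ γ f) = (c : ℂ) • fun u => (f : X → ℂ) (-u))
    (f : SchwartzBruhat X) :
    weylFun β ψ μ γ (fun u => weylFun β ψ μ γ f (-u)) = (c : ℂ) • (f : X → ℂ) := by
  -- `Pf ∈ 𝒮`, `M (P f) ∈ 𝒮`, `g := c⁻¹ • M (P f) ∈ 𝒮`, and `M g = f`.
  set Pf : SchwartzBruhat X := ⟨fun u => (f : X → ℂ) (-u), reflect_mem_schwartzBruhat f.2⟩ with hPf
  set MPf : SchwartzBruhat X := ⟨weylFun β ψ μ γ Pf, hW Pf⟩ with hMPf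
  have hMM : weylFun β ψ μ γ (weylFun β ψ μ γ Pf) = (c : ℂ) • (f : X → ℂ) := by
    rw [hinv Pf]; congr 1; funext u; simp [hPf]
  set g : SchwartzBruhat X := (c⁻¹ : ℂˣ) • MPf with hg
  have hMg : weylFun β ψ μ γ g = f := by
    have : ((g : SchwartzBruhat X) : X → ℂ) = ((c⁻¹ : ℂˣ) : ℂ) • weylFun β ψ μ γ Pf := rfl
    rw [this, weylFun_smul, hMM, smul_smul, Units.inv_mul, one_smul]
  -- now `M P M f = M P M M g = M P (c P g) = c M g = c f`
  have hPMM : (fun u => weylFun β ψ μ γ f (-u)) = (c : ℂ) • ((g : SchwartzBruhat X) : X → ℂ) := by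
    rw [← hMg, hinv g]; funext u; simp
  rw [hPMM, weylFun_smul, hMg]

/-- **the Weyl operator as a linear automorphism of `𝒮(X)`**, with explicit inverse `f ↦ c⁻¹ · (weylFun f)(-·)`, under
the hypotheses (i) stability of `𝒮(X)` and (ii) the inversion formula `M² = c · P`. [cite: Weil1964, n° 13, p. 160] -/
def weylEquivSB (hψ : IsLocallyConstant (⇑ψ : R → Circle)) (hβ : ∀ w : Y, Continuous fun v : X => β v w)
    (hW : ∀ f : SchwartzBruhat X, weylFun β ψ μ γ f ∈ SchwartzBruhat X) (c : ℂˣ)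
    (hinv : ∀ f : SchwartzBruhat X,
      weylFun β ψ μ γ (weylFun β ψ μ γ f) = (c : ℂ) • fun u => (f : X → ℂ) (-u)) :
    SchwartzBruhat X ≃ₗ[ℂ] SchwartzBruhat X where
  toFun f := ⟨weylFun β ψ μ γ f, hW f⟩
  map_add' f g := Subtype.ext ((weylSB β ψ μ γ hψ hβ).map_add f g)
  map_smul' a f := Subtype.ext ((weylSB β ψ μ γ hψ hβ).map_smul a f)
  invFun f := ⟨((c⁻¹ : ℂˣ) : ℂ) • fun u => weylFun β ψ μ γ f (-u),
    (SchwartzBruhat X).smul_mem _ (reflect_mem_schwartzBruhat (hW f))⟩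
  left_inv f := by
    apply Subtype.ext
    show ((c⁻¹ : ℂˣ) : ℂ) • (fun u => weylFun β ψ μ γ (weylFun β ψ μ γ f) (-u)) = (f : X → ℂ)
    rw [hinv f]
    funext u
    simp only [Pi.smul_apply, smul_eq_mul, neg_neg, ← mul_assoc, Units.inv_mul, one_mul]
  right_inv f := by
    apply Subtype.ext
    show weylFun β ψ μ γ (((c⁻¹ : ℂˣ) : ℂ) • fun u => weylFun β ψ μ γ f (-u)) = (f : X → ℂ)
    rw [weylFun_smul, weylFun_reflect_weylFun β ψ μ γ hW c hinv f, smul_smul, Units.inv_mul, one_smul]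

/-- formula. [cite: Weil1964, n° 13, p. 160] -/
@[simp] theorem coe_weylEquivSB (hψ : IsLocallyConstant (⇑ψ : R → Circle))
    (hβ : ∀ w : Y, Continuous fun v : X => β v w)
    (hW : ∀ f : SchwartzBruhat X, weylFun β ψ μ γ f ∈ SchwartzBruhat X) (c : ℂˣ)
    (hinv : ∀ f : SchwartzBruhat X,
      weylFun β ψ μ γ (weylFun β ψ μ γ f) = (c : ℂ) • fun u => (f : X → ℂ) (-u)) (f : SchwartzBruhat X) :
    ((weylEquivSB β ψ μ γ hψ hβ hW c hinv f : SchwartzBruhat X) : X → ℂ) = weylFun β ψ μ γ f := rfl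

variable (δ : X ≃ₗ[R] Y) [MeasurableAdd X] [μ.IsAddRightInvariant]

/-- **the Weyl pair lies in the metaplectic-type group of the smooth Schrödinger model**:
`(d₀'(γ,δ), weylEquivSB) ∈ mpPairs (schrodingerSB β ψ)` — MVW's (A) for the Weyl element, KERNEL modulo the
hypotheses (i), (ii). [cite: MoeglinVignerasWaldspurger1987, Chap. 2 II.1 (A)] -/
theorem weylPair_mem_mpPairs (hψ : IsLocallyConstant (⇑ψ : R → Circle))
    (hβ : ∀ w : Y, Continuous fun v : X => β v w)
    (hW : ∀ f : SchwartzBruhat X, weylFun β ψ μ γ f ∈ SchwartzBruhat X) (c : ℂˣ)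
    (hinv : ∀ f : SchwartzBruhat X,
      weylFun β ψ μ γ (weylFun β ψ μ γ f) = (c : ℂ) • fun u => (f : X → ℂ) (-u))
    (hγδ : ∀ (x : X) (y : Y), β (γ y) (δ x) = -β x y) :
    (weylElt β γ δ hγδ, weylEquivSB β ψ μ γ hψ hβ hW c hinv) ∈ mpPairs (schrodingerSB β ψ hψ hβ) := by
  rw [mem_mpPairs]
  intro h f
  apply Subtype.ext
  rw [coe_weylEquivSB, coe_schrodingerSB, coe_schrodingerSB, coe_weylEquivSB, weylFun_schrodinger]

end WeylEquiv



end Literature.RepresentationTheory.HeisenbergGroup
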